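import Mathlib
import HarnessLib
import Literature.MathematicalPhysics.QuantumLattice.FermiRG.FKTLaddersSec1
import Literature.MathematicalPhysics.QuantumLattice.HubbardUmklappKinematics

/-!
# Route `KLProgramme` (crux K3, DECOMP C1 / App. E Lemma E.2): the particle–hole-ladder hypothesis set of
# Feldman–Knörrer–Trubowitz 2004, AS TYPED in `FermiRG/FKTLaddersSec1.lean`, is NOT satisfied by a lattice band

Cell `gate-hubbard-kl`, risk-register item r2 (a typing remark for the referees and the K3 provers). The
typer file `FKTLaddersSec1.lean` (t7) records FKT-PHL's standing hypotheses as
`FermiRG.FKTLadders.DispersionHyp e re r0` for a CONTINUUM dispersion `e : ℝ² → ℝ`, demanding in particular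
that the Fermi curve `F = e⁻¹{0} ⊂ ℝ²` (`FKTLadders.fermiCurve`) be COMPACT and CONNECTED; its header says the
square-lattice Hubbard dispersion on the programme's window «satisfies THIS hypothesis set». As typed it
does not, for any `2πℤ²`-periodic dispersion: the `ℝ²`-level set of `ε(k) - μ = -2(cos k₁ + cos k₂) - μ`,
`-4 ≤ μ ≤ 0`, contains the unbounded sequence `(K(μ) + 2πn, 0)` (`K = umklappRadius`, the antinode), so it
is not bounded, hence not compact (`klfs_fkt_fermiCurve_not_isCompact`), and
`¬ FKTLadders.DispersionHyp (ε - μ) rₑ r₀` for all `rₑ, r₀` (`klfs_not_fkt_dispersionHyp`). What IS true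
(and proved in `KLProgrammeFermiSurfaceEnvelope/…/FST2Regularity`) is the hypothesis set on the TORUS /
in the fundamental cell; a torus version of `FKTLadders.fermiCurve` is what an instantiation needs. No
definitions; everything PROVED. [folklore]
-/

noncomputable section

open Real Set

-- the tree's namespace `Summit.<Summit>.<Problem>.Theorems` repeats the summit name by design (D-0017)
set_option linter.dupNamespace false

namespace Summit.HubbardSuperconductivity.HubbardSuperconductivity.Theorems

open Literature.MathematicalPhysics.QuantumLattice

/-- The translated antinodes `(K(μ) + 2πn, 0)` lie on the `ℝ²`-level set `{ε - μ = 0}` (`-4 ≤ μ ≤ 0`).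
[folklore] -/
theorem klfs_fkt_antinode_translate_mem {μ : ℝ} (hμ₁ : -4 ≤ μ) (hμ₂ : μ ≤ 0) (n : ℕ) :
    (![umklappRadius μ + n * (2 * π), 0] : Fin 2 → ℝ) ∈
      FermiRG.FKTLadders.fermiCurve (fun k : Fin 2 → ℝ => sqDispersion k - μ) := by
  have hc : Real.cos (umklappRadius μ) = -μ / 2 - 1 := by
    rw [umklappRadius, Real.cos_arccos (by linarith) (by linarith)]
  show sqDispersion ![umklappRadius μ + n * (2 * π), 0] - μ ∈ ({0} : Set ℝ)
  simp [sqDispersion, Real.cos_add_nat_mul_two_pi, hc]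
  ring

/-- **The `ℝ²`-Fermi curve of the lattice band is not bounded** (`-4 ≤ μ ≤ 0`). [folklore] -/
theorem klfs_fkt_fermiCurve_not_isBounded {μ : ℝ} (hμ₁ : -4 ≤ μ) (hμ₂ : μ ≤ 0) :
    ¬ Bornology.IsBounded (FermiRG.FKTLadders.fermiCurve (fun k : Fin 2 → ℝ => sqDispersion k - μ)) := by
  intro hb
  obtain ⟨C, hC⟩ := hb.exists_norm_le
  obtain ⟨n, hn⟩ := exists_nat_gt C
  have hmem := klfs_fkt_antinode_translate_mem hμ₁ hμ₂ n
  have hle := hC _ hmem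
  have hK := umklappRadius_nonneg μ
  have hcoord : ‖(![umklappRadius μ + n * (2 * π), 0] : Fin 2 → ℝ) 0‖ ≤
      ‖(![umklappRadius μ + n * (2 * π), 0] : Fin 2 → ℝ)‖ := norm_le_pi_norm _ 0
  have h0 : ‖(![umklappRadius μ + n * (2 * π), 0] : Fin 2 → ℝ) 0‖ = umklappRadius μ + n * (2 * π) := by
    simp only [Matrix.cons_val_zero, Real.norm_eq_abs]
    exact abs_of_nonneg (by positivity)
  have hπ : (3 : ℝ) < π := Real.pi_gt_three
  have hn0 : (0 : ℝ) ≤ n := n.cast_nonneg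
  nlinarith

/-- **The `ℝ²`-Fermi curve of the lattice band is not compact** (`-4 ≤ μ ≤ 0`): FKT-PHL's compactness
hypothesis, as typed over the continuum, fails for the Hubbard band (it holds on the torus). [folklore] -/
theorem klfs_fkt_fermiCurve_not_isCompact {μ : ℝ} (hμ₁ : -4 ≤ μ) (hμ₂ : μ ≤ 0) :
    ¬ IsCompact (FermiRG.FKTLadders.fermiCurve (fun k : Fin 2 → ℝ => sqDispersion k - μ)) :=
  fun h => klfs_fkt_fermiCurve_not_isBounded hμ₁ hμ₂ h.isBounded

/-- **`¬ FKTLadders.DispersionHyp (ε - μ) rₑ r₀`** for the lattice band at every `-4 ≤ μ ≤ 0` and all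
`rₑ, r₀`: the typed (continuum) hypothesis set cannot be instantiated at a periodic dispersion; the
programme needs its torus version. [folklore] -/
theorem klfs_not_fkt_dispersionHyp {μ : ℝ} (hμ₁ : -4 ≤ μ) (hμ₂ : μ ≤ 0) (re r0 : ℕ) :
    ¬ FermiRG.FKTLadders.DispersionHyp (fun k : Fin 2 → ℝ => sqDispersion k - μ) re r0 :=
  fun h => klfs_fkt_fermiCurve_not_isCompact hμ₁ hμ₂ h.isCompact

end Summit.HubbardSuperconductivity.HubbardSuperconductivity.Theorems

end
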